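import Literature.NumberTheory.GaloisRepresentations.MackeyInducedIrreducible
import Literature.NumberTheory.GaloisRepresentations.WeilDeligneSemisimpleTraces
import Mathlib.NumberTheory.Padics.Complex
import HarnessLib

/-!
# Block-diagonal framed representations with irreducible blocks: semisimplicity and the
# Jordan–Hölder pick
# (crux `AscentConjugationSolvable`, stmt-Langlands-1094; piece `CyclicPrimeAscent`; lead c3 helper stub H7)

Support file (closes nothing).  Abstract linear algebra over the field `ℚ̄_ℓ = PadicAlgCl ℓ`, for an
arbitrary topological group `G`.  Let `S, S' : G →ₜ* GL_{dm}(ℚ̄_ℓ)` be framed representations whose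
matrices are the block-diagonals `diag(a₀(g),…,a_{d-1}(g))`, resp. `diag(b₀(g),…,b_{d-1}(g))`, in
the frame `finProdFinEquiv : Fin d × Fin m ≃ Fin (d m)` (the shape produced by
`FramedGaloisRep.induce_restrictField_apply_coe` for the restriction of an induced representation),
with all blocks `a i`, `b j : G →ₜ* GL_m(ℚ̄_ℓ)` IRREDUCIBLE.  Then

1. `S` is semisimple: the `d` coordinate blocks `V_i ⊆ ℚ̄_ℓ^{dm}` are `S`-stable, `S` acts on
   `V_i` through `a i` (so `V_i` is an irreducible subrepresentation, being the image of the
   injective `G`-map `v ↦ (0,…,v,…,0)` from `a i`), and `∑ V_i` is everything; a representation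
   generated by semisimple subrepresentations is semisimple
   (`Representation.isSemisimpleRepresentation_of_iSup_toSubmodule_eq_top`).
2. The pick: if `S' = P S P⁻¹`, then for every `j` some block `b j` is conjugate to some block
   `a i`.  Indeed `S'(g) P = P S(g)` reads blockwise `b_j(g) P_{ji} = P_{ji} a_i(g)`; the `j`-th
   block row of the invertible `P` is non-zero, so some `P_{ji} ≠ 0`, and a non-zero intertwiner
   between irreducible representations is invertible (Schur's lemma, Mathlib
   `Representation.IsIrreducible.bijective_or_eq_zero`), whence `b j = P_{ji} a_i P_{ji}⁻¹`.

References: J.-P. Serre, *Linear representations of finite groups*, GTM 42 (1977), §2.2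
(Schur's lemma), §2.3, §7.3; C. W. Curtis, I. Reiner, *Representation theory of finite groups and
associative algebras* (1962), (27.3).
-/

noncomputable section

set_option linter.dupNamespace false -- project-wide option; `Summit.Langlands.Langlands` is the mandated namespace

namespace Summit.Langlands.Langlands.Theorems.SmithKummerSeedCyclicPrimeAscent

open scoped MatrixGroups NumberField Classical Matrix Polynomial
open Filter IsDedekindDomain Field
open Literature.NumberTheory.GaloisRepresentations

/-! ### Block calculus in the frame `finProdFinEquiv`

Throughout, `diag(B₀,…,B_{d-1})` is the matrix
`Matrix.reindex finProdFinEquiv finProdFinEquiv (Matrix.comp _ _ _ _ A (Matrix.diagonal B))` and the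
`(j, i)` block of a `d m × d m` matrix `P` is `Matrix.of fun x y => P (finProdFinEquiv (j, x)) (finProdFinEquiv (i, y))`. -/

section Blocks

variable {A : Type} [CommRing A] {d m : ℕ}

/-- Entries of the block-diagonal matrix `diag(B₀,…,B_{d-1})`. [folklore] -/
private theorem diagBlocks_apply (B : Fin d → Matrix (Fin m) (Fin m) A) (j i : Fin d)
    (x y : Fin m) :
    Matrix.reindex finProdFinEquiv finProdFinEquiv
      (Matrix.comp (Fin d) (Fin d) (Fin m) (Fin m) A (Matrix.diagonal B))
        (finProdFinEquiv (j, x)) (finProdFinEquiv (i, y)) =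
      if j = i then B j x y else 0 := by
  rw [Matrix.reindex_apply, Matrix.submatrix_apply, Equiv.symm_apply_apply,
    Equiv.symm_apply_apply, Matrix.comp_apply]
  by_cases h : j = i
  · subst h
    rw [if_pos rfl, Matrix.diagonal_apply_eq]
  · rw [if_neg h, Matrix.diagonal_apply_ne _ h, Matrix.zero_apply]

/-- A block-diagonal matrix acts on the `i`-th coordinate block (the image of a block inclusion
`e : v ↦ (0,…,0,v,0,…,0)`) through its `i`-th block. [folklore] -/
private theorem diagBlocks_mulVec_of_block (B : Fin d → Matrix (Fin m) (Fin m) A) (i : Fin d)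
    (e : (Fin m → A) → (Fin (d * m) → A))
    (he : ∀ v j y, e v (finProdFinEquiv (j, y)) = if j = i then v y else 0) (v : Fin m → A) :
    Matrix.reindex finProdFinEquiv finProdFinEquiv
      (Matrix.comp (Fin d) (Fin d) (Fin m) (Fin m) A (Matrix.diagonal B)) *ᵥ e v = e (B i *ᵥ v) := by
  funext x
  obtain ⟨⟨j, c⟩, rfl⟩ := finProdFinEquiv.surjective x
  rw [he, Matrix.mulVec, dotProduct, ← finProdFinEquiv.sum_comp, Fintype.sum_prod_type,
    Finset.sum_eq_single i]
  · by_cases hji : j = i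
    · subst hji
      rw [if_pos rfl, Matrix.mulVec, dotProduct]
      refine Finset.sum_congr rfl fun t _ => ?_
      rw [diagBlocks_apply, if_pos rfl, he, if_pos rfl]
    · rw [if_neg hji]
      refine Finset.sum_eq_zero fun t _ => ?_
      rw [diagBlocks_apply, if_neg hji, zero_mul]
  · intro k _ hki
    refine Finset.sum_eq_zero fun t _ => ?_
    rw [he, if_neg hki, mul_zero]
  · intro hi
    exact absurd (Finset.mem_univ i) hi

/-- Blocks of a product with a block-diagonal matrix on the left. [folklore] -/
private theorem subBlock_diagBlocks_mul (B : Fin d → Matrix (Fin m) (Fin m) A)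
    (P : Matrix (Fin (d * m)) (Fin (d * m)) A) (j i : Fin d) :
    Matrix.of (fun x y => (Matrix.reindex finProdFinEquiv finProdFinEquiv
        (Matrix.comp (Fin d) (Fin d) (Fin m) (Fin m) A (Matrix.diagonal B)) * P)
          (finProdFinEquiv (j, x)) (finProdFinEquiv (i, y))) =
      B j * Matrix.of fun x y => P (finProdFinEquiv (j, x)) (finProdFinEquiv (i, y)) := by
  ext x y
  simp only [Matrix.of_apply, Matrix.mul_apply]
  rw [← finProdFinEquiv.sum_comp, Fintype.sum_prod_type, Finset.sum_eq_single j]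
  · refine Finset.sum_congr rfl fun t _ => ?_
    rw [diagBlocks_apply, if_pos rfl]
  · intro k _ hkj
    refine Finset.sum_eq_zero fun t _ => ?_
    rw [diagBlocks_apply, if_neg (Ne.symm hkj), zero_mul]
  · intro h
    exact absurd (Finset.mem_univ j) h

/-- Blocks of a product with a block-diagonal matrix on the right. [folklore] -/
private theorem subBlock_mul_diagBlocks (B : Fin d → Matrix (Fin m) (Fin m) A)
    (P : Matrix (Fin (d * m)) (Fin (d * m)) A) (j i : Fin d) :
    Matrix.of (fun x y => (P * Matrix.reindex finProdFinEquiv finProdFinEquiv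
        (Matrix.comp (Fin d) (Fin d) (Fin m) (Fin m) A (Matrix.diagonal B)))
          (finProdFinEquiv (j, x)) (finProdFinEquiv (i, y))) =
      (Matrix.of fun x y => P (finProdFinEquiv (j, x)) (finProdFinEquiv (i, y))) * B i := by
  ext x y
  simp only [Matrix.of_apply, Matrix.mul_apply]
  rw [← finProdFinEquiv.sum_comp, Fintype.sum_prod_type, Finset.sum_eq_single i]
  · refine Finset.sum_congr rfl fun t _ => ?_
    rw [diagBlocks_apply, if_pos rfl]
  · intro k _ hki
    refine Finset.sum_eq_zero fun t _ => ?_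
    rw [diagBlocks_apply, if_neg hki, mul_zero]
  · intro h
    exact absurd (Finset.mem_univ i) h

end Blocks

/-! ### Semisimplicity and Schur's lemma for framed representations -/

section Framed

variable {G : Type} [Group G] [TopologicalSpace G] {A : Type} [Field A] [TopologicalSpace A]
  [IsTopologicalRing A] {d m : ℕ}

/-- **A block-diagonal framed representation with irreducible blocks is semisimple**: the
coordinate blocks are irreducible subrepresentations (images of the injective `G`-maps
`v ↦ (0,…,0,v,0,…,0)` from the blocks `a i`) and they span. [cite: SerreLinearRepresentations1977, §2.3 and §7.3] -/
private theorem isSemisimple_of_diagBlocks (S : FramedRep G A (d * m)) (a : Fin d → FramedRep G A m)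
    (hS : ∀ g, ((S g : GL (Fin (d * m)) A) : Matrix (Fin (d * m)) (Fin (d * m)) A) =
      Matrix.reindex finProdFinEquiv finProdFinEquiv (Matrix.comp (Fin d) (Fin d) (Fin m) (Fin m) A
        (Matrix.diagonal fun i => ((a i g : GL (Fin m) A) : Matrix (Fin m) (Fin m) A))))
    (ha : ∀ i, (a i).IsIrreducible) : S.toContinuousRep.IsSemisimple := by
  -- the block inclusions `v ↦ (0,…,0,v,0,…,0)`, as linear maps and as `G`-maps `a i → S`
  let incl : Fin d → (Fin m → A) →ₗ[A] (Fin (d * m) → A) := fun i =>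
    { toFun := fun v x => if (finProdFinEquiv.symm x).1 = i then v (finProdFinEquiv.symm x).2 else 0
      map_add' := fun v w => by
        funext x
        simp only [Pi.add_apply]
        split_ifs <;> simp
      map_smul' := fun c v => by
        funext x
        simp only [Pi.smul_apply, smul_eq_mul, RingHom.id_apply]
        split_ifs <;> simp }
  have hincl : ∀ i v j y, incl i v (finProdFinEquiv (j, y)) = if j = i then v y else 0 := by
    intro i v j y
    change (if (finProdFinEquiv.symm (finProdFinEquiv (j, y))).1 = i then
      v (finProdFinEquiv.symm (finProdFinEquiv (j, y))).2 else 0) = _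
    rw [Equiv.symm_apply_apply]
  let ι : ∀ i : Fin d, (a i).toRepresentation.IntertwiningMap S.toRepresentation := fun i =>
    LinearMap.intertwiningMap_of_isIntertwiningMap (a i).toRepresentation S.toRepresentation
      (incl i) fun g v => by
        simp only [FramedRep.toRepresentation_apply_apply]
        rw [hS g, diagBlocks_mulVec_of_block _ i (incl i) (hincl i)]
  have hleft : ∀ i v y, (ι i) v (finProdFinEquiv (i, y)) = v y := fun i v y => by
    change incl i v (finProdFinEquiv (i, y)) = v y
    rw [hincl, if_pos rfl]
  have hinj : ∀ i, Function.Injective (ι i) := fun i v w hvw => funext fun y => by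
    rw [← hleft i v y, ← hleft i w y, hvw]
  have hirr : ∀ i, (ι i).range.toRepresentation.IsIrreducible := fun i =>
    haveI : (a i).toRepresentation.IsIrreducible := ha i
    Literature.RepresentationTheory.Semisimple.Representation.isIrreducible_of_equiv
      (Literature.RepresentationTheory.FiniteGroups.Subrepresentation.equivRange (ι i) (hinj i))
  change S.toRepresentation.IsSemisimpleRepresentation
  refine Representation.isSemisimpleRepresentation_of_iSup_toSubmodule_eq_top
    (fun i => (ι i).range) (fun i => ?_) ?_
  · haveI := hirr i
    infer_instance
  · rw [eq_top_iff]
    rintro w -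
    have hw : w = ∑ k, incl k (fun y => w (finProdFinEquiv (k, y))) := by
      funext x
      obtain ⟨⟨j, c⟩, rfl⟩ := finProdFinEquiv.surjective x
      rw [Finset.sum_apply]
      simp only [hincl]
      rw [Finset.sum_ite_eq Finset.univ j, if_pos (Finset.mem_univ _)]
    rw [hw]
    refine Submodule.sum_mem _ fun k _ => Submodule.mem_iSup_of_mem k ?_
    change incl k _ ∈ LinearMap.range (ι k).toLinearMap
    exact LinearMap.mem_range.2 ⟨_, rfl⟩

/-- **Schur's lemma, framed form**: a non-zero matrix `N` intertwining two IRREDUCIBLE framed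
representations of the same rank (`b(g) N = N a(g)`) is invertible, so `b = N a N⁻¹`
(Mathlib `Representation.IsIrreducible.bijective_or_eq_zero`). [cite: SerreLinearRepresentations1977, §2.2 Prop. 4] -/
private theorem exists_eq_conj_of_intertwiner {a b : FramedRep G A m} (ha : a.IsIrreducible)
    (hb : b.IsIrreducible) (N : Matrix (Fin m) (Fin m) A) (hN : N ≠ 0)
    (hint : ∀ g, ((b g : GL (Fin m) A) : Matrix (Fin m) (Fin m) A) * N =
      N * ((a g : GL (Fin m) A) : Matrix (Fin m) (Fin m) A)) :
    ∃ Q : GL (Fin m) A, b = FramedRep.conj Q a := by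
  let T : a.toRepresentation.IntertwiningMap b.toRepresentation :=
    LinearMap.intertwiningMap_of_isIntertwiningMap a.toRepresentation b.toRepresentation
      N.mulVecLin fun g v => by
        simp only [FramedRep.toRepresentation_apply_apply, Matrix.mulVecLin_apply,
          Matrix.mulVec_mulVec, hint g]
  haveI : a.toRepresentation.IsIrreducible := ha
  haveI : b.toRepresentation.IsIrreducible := hb
  have hT : Function.Bijective T := by
    refine (Representation.IsIrreducible.bijective_or_eq_zero T).resolve_right fun h => hN ?_
    ext x y
    have hv := congrArg
      (fun f : a.toRepresentation.IntertwiningMap b.toRepresentation => f (Pi.single y 1) x) h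
    change (N *ᵥ Pi.single y 1) x = 0 at hv
    rwa [Matrix.mulVec_single_one] at hv
  have hNinj : Function.Injective N.mulVec := fun v w hvw => hT.1 hvw
  have hU : IsUnit N := Matrix.mulVec_injective_iff_isUnit.1 hNinj
  refine ⟨hU.unit, ContinuousMonoidHom.ext fun g => Units.ext ?_⟩
  rw [FramedRep.conj_apply, Units.val_mul, Units.val_mul, IsUnit.unit_spec, ← hint g, mul_assoc,
    IsUnit.mul_val_inv, mul_one]

end Framed

/-- HELPER STUB H7 — **block-diagonal framed representations with IRREDUCIBLE blocks: semisimplicity, and the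
Jordan–Hölder pick** (abstract, any topological group `G`, coefficients `ℚ̄_ℓ`): if `S`, `S'` are framed
representations of rank `d·m` whose matrices are the block-diagonals `diag(a₀,…,a_{d-1})`, `diag(b₀,…,b_{d-1})`
(frame `finProdFinEquiv`, the shape of `induce_restrictField_apply_coe`) of irreducible framed representations,
then `S` is semisimple, and if moreover `S' = P S P⁻¹` then every block `b j` is conjugate to some block `a i`
(Schur: a non-zero intertwiner between irreducibles is invertible). [cite: SerreLinearRepresentations1977, §2.3 and §7.3]
[cite: CurtisReiner1962, (27.3)] -/
theorem blockDiagonal_semisimple_and_pick : ∀ (G : Type) [Group G] [TopologicalSpace G] [IsTopologicalGroup G] (ℓ : ℕ) [Fact ℓ.Prime] (d m : ℕ) (a b : Fin d → Literature.NumberTheory.GaloisRepresentations.FramedRep G (PadicAlgCl ℓ) m) (S S' : Literature.NumberTheory.GaloisRepresentations.FramedRep G (PadicAlgCl ℓ) (d * m)), (∀ g : G, ((S g : GL (Fin (d * m)) (PadicAlgCl ℓ)) : Matrix (Fin (d * m)) (Fin (d * m)) (PadicAlgCl ℓ)) = Matrix.reindex finProdFinEquiv finProdFinEquiv (Matrix.comp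 (Fin d) (Fin d) (Fin m) (Fin m) (PadicAlgCl ℓ) (Matrix.diagonal fun i => ((a i g : GL (Fin m) (PadicAlgCl ℓ)) : Matrix (Fin m) (Fin m) (PadicAlgCl ℓ))))) → (∀ g : G, ((S' g : GL (Fin (d * m)) (PadicAlgCl ℓ)) : Matrix (Fin (d * m)) (Fin (d * m)) (PadicAlgCl ℓ)) = Matrix.reindex finProdFinEquiv finProdFinEquiv (Matrix.comp (Fin d) (Fin d) (Fin m) (Fin m) (PadicAlgCl ℓ) (Matrix.diagonal fun i => ((b i g : GL (Fin m) (PadicAlgCl ℓ)) : Matrix (Fin m) (Fin m) (PadicAlgCl ℓ))))) → (∀ i, (a i).IsIrreducible) → (∀ i, (b i).IsIrreducible) → S.toContinuousRep.IsSemisimple ∧ ∀ P : GL (Fin (d * m)) (PadicAlgCl ℓ), S' = Literature.NumberTheory.GaloisRepresentations.FramedRep.conj P S → ∀ j : Fin d, ∃ (i : Fin d) (Q : GL (Fin m) (PadicAlgCl ℓ)), b j = Literature.NumberTheory.GaloisRepresentations.FramedRep.conj Q (a i) := by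
  intro G _ _ _ ℓ _ d m a b S S' hS hS' ha hb
  refine ⟨isSemisimple_of_diagBlocks S a hS ha, fun P hP j => ?_⟩
  -- `S'(g) P = P S(g)` as matrices, hence blockwise `b_j(g) P_{ji} = P_{ji} a_i(g)`
  have hint : ∀ g, Matrix.reindex finProdFinEquiv finProdFinEquiv (Matrix.comp (Fin d) (Fin d)
        (Fin m) (Fin m) (PadicAlgCl ℓ) (Matrix.diagonal fun i => ((b i g : GL (Fin m) (PadicAlgCl ℓ)) :
          Matrix (Fin m) (Fin m) (PadicAlgCl ℓ)))) * (P : Matrix (Fin (d * m)) (Fin (d * m)) (PadicAlgCl ℓ)) =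
      (P : Matrix (Fin (d * m)) (Fin (d * m)) (PadicAlgCl ℓ)) *
        Matrix.reindex finProdFinEquiv finProdFinEquiv (Matrix.comp (Fin d) (Fin d) (Fin m) (Fin m)
          (PadicAlgCl ℓ) (Matrix.diagonal fun i => ((a i g : GL (Fin m) (PadicAlgCl ℓ)) :
            Matrix (Fin m) (Fin m) (PadicAlgCl ℓ)))) := by
    intro g
    have h1 : S' g * P = P * S g := by
      rw [hP, FramedRep.conj_apply, inv_mul_cancel_right]
    have h2 := congrArg (fun u : GL (Fin (d * m)) (PadicAlgCl ℓ) =>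
      (u : Matrix (Fin (d * m)) (Fin (d * m)) (PadicAlgCl ℓ))) h1
    simp only [Units.val_mul, hS g, hS' g] at h2
    exact h2
  -- the blocks `P_{ji}` of `P`
  set blk : Fin d → Matrix (Fin m) (Fin m) (PadicAlgCl ℓ) := fun i => Matrix.of fun x y =>
    (P : Matrix (Fin (d * m)) (Fin (d * m)) (PadicAlgCl ℓ)) (finProdFinEquiv (j, x)) (finProdFinEquiv (i, y))
    with hblk_def
  have hblk : ∀ i g, ((b j g : GL (Fin m) (PadicAlgCl ℓ)) : Matrix (Fin m) (Fin m) (PadicAlgCl ℓ)) *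
      blk i = blk i * ((a i g : GL (Fin m) (PadicAlgCl ℓ)) : Matrix (Fin m) (Fin m) (PadicAlgCl ℓ)) := by
    intro i g
    have h := congrArg (fun M : Matrix (Fin (d * m)) (Fin (d * m)) (PadicAlgCl ℓ) =>
      Matrix.of fun x y => M (finProdFinEquiv (j, x)) (finProdFinEquiv (i, y))) (hint g)
    simpa only [subBlock_diagBlocks_mul, subBlock_mul_diagBlocks] using h
  -- the `j`-th block row of the invertible matrix `P` is non-zero
  have hm : 0 < m := (hb j).rank_pos
  obtain ⟨i, hi⟩ : ∃ i, blk i ≠ 0 := by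
    by_contra hcon
    simp only [not_exists, not_not] at hcon
    have hdet : ((P : GL (Fin (d * m)) (PadicAlgCl ℓ)) :
        Matrix (Fin (d * m)) (Fin (d * m)) (PadicAlgCl ℓ)).det = 0 := by
      refine Matrix.det_eq_zero_of_row_eq_zero (finProdFinEquiv (j, ⟨0, hm⟩)) fun z => ?_
      obtain ⟨⟨i, y⟩, rfl⟩ := finProdFinEquiv.surjective z
      have := congrFun (congrFun (hcon i) ⟨0, hm⟩) y
      simpa only [hblk_def, Matrix.of_apply, Matrix.zero_apply] using this
    exact ((Matrix.isUnit_iff_isUnit_det _).1 P.isUnit).ne_zero hdet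
  -- Schur
  obtain ⟨Q, hQ⟩ := exists_eq_conj_of_intertwiner (ha i) (hb j) _ hi (hblk i)
  exact ⟨i, Q, hQ⟩

end Summit.Langlands.Langlands.Theorems.SmithKummerSeedCyclicPrimeAscent
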